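import Literature.NumberTheory.EllipticCurves.ZpExtensionEisensteinDVRSettingTame
import Literature.NumberTheory.EllipticCurves.ZpExtensionEisensteinDVRSettingSelmerCompatProofs
import Literature.NumberTheory.EllipticCurves.ZpExtensionEisensteinDVRSettingHypothesesProofs
import Literature.NumberTheory.EllipticCurves.HeegnerPointsImaginaryQuadraticProofs
import Literature.NumberTheory.GaloisCohomology.Howard2004.FiniteSingularTameTower
import HarnessLib

/-!
# The Eisenstein `DVRSetting` of the curve with lit's LEVEL-SET-GUARDED tame slots `tameSlotOn` (the guard shared with
# the Λ-adic source of the Kolyvagin system), its `fs_admissible` / `fs_natural`, and `SatisfiesH` assembled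

Topic `NumberTheory/EllipticCurves` (D1 road of cell `pub/bsd-print-x9`; companion of `ZpExtensionEisensteinDVRSettingTame`
(p652144) and `ZpExtensionEisensteinDVRSettingSatisfiesH` (p653070); consumer of lit's `Howard2004/FiniteSingularTameTower`
(`tameSlotOn`, p652046)).  Definitions with bodies + theorems; no named fact, no instance, no notation, no `sorry`.

WHY a second tame variant (x9-p2 g4, INTERFACE NOTE 2026-08-28): the ONE tower morphism `S_Λ.reindex σ → St` carrying
the Λ-adic Kolyvagin system onto the Eisenstein setting needs `CoeffTowerSetting.Hom.fs_compat` at ALL `(k, n, v)`, which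
holds for guarded tame slots iff source and target use the SAME pin `π` and the SAME presentation-independent guard.
`eisensteinTameFs` (p652144) is guarded by a TARGET-tower predicate (`TameHyp` at every level); here the guard is the
level-set predicate `P n v := n ∈ levels 𝓛 ∧ v ∈ n` of lit's `tameSlotOn` — shared verbatim by the source.
* `WeierstrassCurve.eisensteinLevels_tameHyp` — on the guard, `TameHyp` holds for `T^{(k)}/I_n` (H.0 + `tameHyp_of_mem_levels_of_h0`);
* **`WeierstrassCurve.eisensteinLevelsTameFs π … k := tameSlotOn π (T^{(k)}/I_·) (fun n v ↦ n ∈ levels 𝓛 ∧ v ∈ n) _`**;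
* **`WeierstrassCurve.eisensteinDVRSettingLevelsTame`** := `eisensteinDVRSetting … (eisensteinLevelsTameFs …)` (`_eq`, `_LD_fs` rfl);
* **`eisensteinDVRSettingLevelsTame_fs_admissible`**, **`_fs_natural`** (lit's `DVRSetting.fs_admissible_of_fs_eq_tameSlotOn_levels` /
  `fs_natural_of_fs_eq_tameSlotOn`, the latter fed with D1's `eisensteinDVRSetting_fsQ_spec`);
* **`eisensteinDVRSettingLevelsTame_satisfiesH_of`** — `St.SatisfiesH` assembled exactly as in p653070 (24 fields by the D1
  kernel theorems, the same EIGHT named open inputs `hp2 hK h2 h3 h4 he_red h5b h5c`, plus `(hirr, hschur)`, `(hc₀, hτ)`).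
Every statement about the setting carries the CONSUMER PREAMBLE of `ZpExtensionEisensteinDVRSetting`.  BSD is not proved.

References: [Howard2004HeegnerKolyvagin] Def. 1.1.8, Def. 1.2.3, §1.3 H.0–H.5, §1.6 (arXiv pp. 5–8, 11); [MazurRubinMemoirs2004]
Def. 1.2.2; [Gross1984] §1.
-/

set_option autoImplicit false

noncomputable section

open Function NumberField IsDedekindDomain Field
open scoped NumberField ContRepresentation TensorProduct Classical

namespace WeierstrassCurve

open Literature.NumberTheory.EllipticCurves Literature.NumberTheory.GaloisRepresentations
open Literature.NumberTheory.GaloisRepresentations.DiscreteGaloisModule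
open Literature.NumberTheory.GaloisCohomology.Howard2004
open Literature.NumberTheory.EllipticCurves.ZpExtension (EisensteinLevel)

variable {K : Type} [Field K] [NumberField K] (W : WeierstrassCurve ℚ) [W.IsElliptic] {p : ℕ} [hp : Fact p.Prime]
  (κ : ZpExtension K p) {m : ℕ} (hm : 1 ≤ m) (π : ∀ v : HeightOneSpectrum (𝓞 K), TamePin v)
  (S : Finset (HeightOneSpectrum (𝓞 K)))
  (hpS : ∀ v : HeightOneSpectrum (𝓞 K), ((p : ℕ) : 𝓞 K) ∈ v.asIdeal → v ∈ S)
  (hbad : ∀ v : HeightOneSpectrum (𝓞 K), v ∉ S → ((p : ℕ) : 𝓞 K) ∉ v.asIdeal → (W.baseChange K).HasGoodReductionAt v)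
  (L : Set (HeightOneSpectrum (𝓞 K)))
  (hL : letI := IwasawaAlgebra.isLocalRing_quotient_X_pow_add_C p hm
    L ⊆ (W.eisensteinTower κ hm).degreeTwoPrimes p)
  (hLS : ∀ v ∈ L, v ∉ S)

include hpS hbad hL hLS in
/-- **On the level-set guard `n ∈ 𝓝(𝓛) ∧ λ ∈ n`, the tame hypotheses hold for `T^{(k)}/I_n T^{(k)}`** (H.0 for
`E_K[p^{k+1}] ⊗ A_{m,k+1}`, `howardH0_twisted_geomTorsion`, and lit's `tameHyp_of_mem_levels_of_h0` on the canonical level data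
of the triple `(T^{(k)}, F_𝔮, 𝓛)`). [cite: Howard2004HeegnerKolyvagin, Def. 1.2.1–1.2.3 and H.0 (arXiv p. 6 L57–75, p. 7 L57)] -/
theorem eisensteinLevels_tameHyp (k : ℕ) (n : Finset (HeightOneSpectrum (𝓞 K))) (v : HeightOneSpectrum (𝓞 K))
    (h : n ∈ levels L ∧ v ∈ n) :
    letI := IwasawaAlgebra.isLocalRing_quotient_X_pow_add_C p hm
    TameHyp (fun n ↦ W.eisensteinLevelQuot κ hm k n) n v := by
  letI := IwasawaAlgebra.isLocalRing_quotient_X_pow_add_C p hm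
  have hpK : (p : K) ≠ 0 := by exact_mod_cast hp.out.ne_zero
  have h0 : H0 (IwasawaAlgebra.EisensteinCoeff p m (k + 1)) (EisensteinLevel p m (fun j ↦ geomTorsion (W.baseChange K) ((p : ℤ) ^ j)) (k + 1)) :=
    (W.baseChange K).howardH0_twisted_geomTorsion (p := p) (m := m) hpK hm (k := k + 1) k.succ_pos
  exact tameHyp_of_mem_levels_of_h0 h0
    (LevelData.canonical (IwasawaAlgebra.EisensteinCoeff p m (k + 1)) ((W.eisensteinTower κ hm).ρ k)
      (κ.isScalarLinear_eisensteinAdicTowerSucc_coeff (fun j ↦ (W.baseChange K).torsionGaloisModule ((p : ℤ) ^ j))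
        (fun j ↦ (W.baseChange K).torsionGaloisModuleReduce p j) hm
        (fun j ↦ (W.baseChange K).torsionGaloisModuleReduce_surjective p j) k)
      (W.eisensteinTowerTriple κ hm S hpS hbad L hL hLS k) (fun _ _ ↦ 0))
    rfl n v h

/-- **The level-set-guarded tame slot of the curve's Eisenstein setting at tower level `k`**: lit's `tameSlotOn` with the
pin `π`, the canonical Kolyvagin quotients `T^{(k)}/I_n`, and the presentation-independent guard `n ∈ 𝓝(𝓛) ∧ λ ∈ n`.
[cite: Howard2004HeegnerKolyvagin, Def. 1.1.8 / Def. 1.2.3 and §1.6 (arXiv p. 5 L144–149, p. 6 L126–131, p. 11 L45–54)] -/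
def eisensteinLevelsTameFs (k : ℕ) (n : Finset (HeightOneSpectrum (𝓞 K))) (v : HeightOneSpectrum (𝓞 K)) :
    letI := IwasawaAlgebra.isLocalRing_quotient_X_pow_add_C p hm
    galoisCohomology ((W.eisensteinLevelQuot κ hm k n).toLocal (Sum.inr v)) 1 →+
      SingularQuotient (GaloisRep.toLocal v (W.eisensteinLevelQuot κ hm k n)) ⊗[ℤ] Gell v :=
  letI := IwasawaAlgebra.isLocalRing_quotient_X_pow_add_C p hm
  haveI := fun n ↦ W.finite_eisensteinLevelQuotCarrier (K := K) (p := p) κ hm k n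
  tameSlotOn π (fun n ↦ W.eisensteinLevelQuot κ hm k n) (fun n v ↦ n ∈ levels L ∧ v ∈ n)
    (W.eisensteinLevels_tameHyp κ hm S hpS hbad L hL hLS k) n v

variable (jbar : AlgebraicClosure K →+* ℂ) (cd : ConjugationDatum K)
  (D : letI := IwasawaAlgebra.isLocalRing_quotient_X_pow_add_C p hm
    ∀ k, DualityDatum p cd ((W.eisensteinTower κ hm).ρ k) (IwasawaAlgebra.EisensteinCoeff p m (k + 1)))

set_option synthInstance.maxHeartbeats 80000 in
/-- **The Eisenstein specialisation of `E_K` with the LEVEL-SET-GUARDED tame slots** (`fs := eisensteinLevelsTameFs π …`).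
[cite: Howard2004HeegnerKolyvagin, §1.6 (arXiv p. 11 L13–38), Def. 1.1.8, Def. 1.2.3] -/
def eisensteinDVRSettingLevelsTame :
    letI := IwasawaAlgebra.isDomain_quotient_X_pow_add_C p hm
    letI := IwasawaAlgebra.isDiscreteValuationRing_quotient_X_pow_add_C p hm
    haveI := IwasawaAlgebra.EisensteinCoeff.isLocalRing_succ p hm
    letI := IwasawaAlgebra.EisensteinCoeff.algebraOfSpecSucc p m
    haveI := W.isScalarTower_algebraOfSpecSucc (K := K) (p := p) (m := m)
    letI := W.residueModuleSucc (K := K) (p := p) hm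
    DVRSetting p K (IwasawaAlgebra p ⧸
        Ideal.span {(PowerSeries.X ^ m + PowerSeries.C (p : ℤ_[p]) : IwasawaAlgebra p)})
      (fun k ↦ EisensteinLevel p m (fun j ↦ geomTorsion (W.baseChange K) ((p : ℤ) ^ j)) (k + 1))
      (fun k ↦ IwasawaAlgebra.EisensteinCoeff p m (k + 1)) (geomTorsion (W.baseChange K) (p : ℤ))
      (fun k n ↦ LevelData.QuotCarrier (IwasawaAlgebra.EisensteinCoeff p m (k + 1)) ((W.eisensteinTower κ hm).ρ k) n) :=
  W.eisensteinDVRSetting κ hm S hpS hbad L hL hLS jbar cd D (W.eisensteinLevelsTameFs κ hm π S hpS hbad L hL hLS)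

set_option synthInstance.maxHeartbeats 80000 in
/-- Unfolding: the levels-tame setting IS `eisensteinDVRSetting` at `fs := eisensteinLevelsTameFs π …` (so every
`eisensteinDVRSetting_*` theorem applies to it). [cite: Howard2004HeegnerKolyvagin, §1.6 (arXiv p. 11 L13–38)] -/
theorem eisensteinDVRSettingLevelsTame_eq :
    letI := IwasawaAlgebra.isDomain_quotient_X_pow_add_C p hm
    letI := IwasawaAlgebra.isDiscreteValuationRing_quotient_X_pow_add_C p hm
    haveI := IwasawaAlgebra.EisensteinCoeff.isLocalRing_succ p hm
    letI := IwasawaAlgebra.EisensteinCoeff.algebraOfSpecSucc p m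
    haveI := W.isScalarTower_algebraOfSpecSucc (K := K) (p := p) (m := m)
    letI := W.residueModuleSucc (K := K) (p := p) hm
    (W.eisensteinDVRSettingLevelsTame κ hm π S hpS hbad L hL hLS jbar cd D) = W.eisensteinDVRSetting κ hm S hpS hbad L hL hLS jbar cd D (W.eisensteinLevelsTameFs κ hm π S hpS hbad L hL hLS) :=
  rfl

set_option synthInstance.maxHeartbeats 80000 in
/-- The slots of the levels-tame setting are lit's `tameSlotOn` with the level-set guard (by `rfl`) — the `hfs` input of
`DVRSetting.fs_admissible_of_fs_eq_tameSlotOn_levels` / `fs_natural_of_fs_eq_tameSlotOn` and of `Hom.fs_compat` arguments.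
[cite: Howard2004HeegnerKolyvagin, Def. 1.2.3 (arXiv p. 6, L126–131)] -/
theorem eisensteinDVRSettingLevelsTame_LD_fs (k : ℕ) :
    letI := IwasawaAlgebra.isDomain_quotient_X_pow_add_C p hm
    letI := IwasawaAlgebra.isDiscreteValuationRing_quotient_X_pow_add_C p hm
    haveI := IwasawaAlgebra.EisensteinCoeff.isLocalRing_succ p hm
    letI := IwasawaAlgebra.EisensteinCoeff.algebraOfSpecSucc p m
    haveI := W.isScalarTower_algebraOfSpecSucc (K := K) (p := p) (m := m)
    letI := W.residueModuleSucc (K := K) (p := p) hm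
    haveI := fun k n ↦ W.finite_eisensteinLevelQuotCarrier (K := K) (p := p) κ hm k n
    ((W.eisensteinDVRSettingLevelsTame κ hm π S hpS hbad L hL hLS jbar cd D).LD k).fs =
      tameSlotOn π ((W.eisensteinDVRSettingLevelsTame κ hm π S hpS hbad L hL hLS jbar cd D).LD k).ρq (fun n v ↦ n ∈ levels (W.eisensteinDVRSettingLevelsTame κ hm π S hpS hbad L hL hLS jbar cd D).L ∧ v ∈ n)
        (fun n v h ↦ W.eisensteinLevels_tameHyp κ hm S hpS hbad L hL hLS k n v h) :=
  rfl

set_option synthInstance.maxHeartbeats 80000 in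
/-- **`SatisfiesH.fs_admissible` for the levels-tame Eisenstein setting** (lit's
`DVRSetting.fs_admissible_of_fs_eq_tameSlotOn_levels`). [cite: Howard2004HeegnerKolyvagin, Def. 1.1.8 and Def. 1.2.3 (arXiv p. 5 L144–149, p. 7 L1–12)] -/
theorem eisensteinDVRSettingLevelsTame_fs_admissible (k : ℕ) :
    letI := IwasawaAlgebra.isDomain_quotient_X_pow_add_C p hm
    letI := IwasawaAlgebra.isDiscreteValuationRing_quotient_X_pow_add_C p hm
    haveI := IwasawaAlgebra.EisensteinCoeff.isLocalRing_succ p hm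
    letI := IwasawaAlgebra.EisensteinCoeff.algebraOfSpecSucc p m
    haveI := W.isScalarTower_algebraOfSpecSucc (K := K) (p := p) (m := m)
    letI := W.residueModuleSucc (K := K) (p := p) hm
    ((W.eisensteinDVRSettingLevelsTame κ hm π S hpS hbad L hL hLS jbar cd D).LD k).IsFsAdmissible := by
  letI := IwasawaAlgebra.isDomain_quotient_X_pow_add_C p hm
  letI := IwasawaAlgebra.isDiscreteValuationRing_quotient_X_pow_add_C p hm
  haveI := IwasawaAlgebra.EisensteinCoeff.isLocalRing_succ p hm
  letI := IwasawaAlgebra.EisensteinCoeff.algebraOfSpecSucc p m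
  haveI := W.isScalarTower_algebraOfSpecSucc (K := K) (p := p) (m := m)
  letI := W.residueModuleSucc (K := K) (p := p) hm
  haveI := fun k n ↦ W.finite_eisensteinLevelQuotCarrier (K := K) (p := p) κ hm k n
  exact DVRSetting.fs_admissible_of_fs_eq_tameSlotOn_levels (W.eisensteinDVRSettingLevelsTame κ hm π S hpS hbad L hL hLS jbar cd D) π (fun _ ↦ rfl)
    (fun k n v h ↦ W.eisensteinLevels_tameHyp κ hm S hpS hbad L hL hLS k n v h) (fun _ ↦ rfl) k

set_option synthInstance.maxHeartbeats 80000 in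
/-- **`SatisfiesH.fs_natural` for the levels-tame Eisenstein setting** (lit's `DVRSetting.fs_natural_of_fs_eq_tameSlotOn`,
fed with D1's `eisensteinDVRSetting_fsQ_spec`). [cite: Howard2004HeegnerKolyvagin, Def. 1.2.3 display (ks relations) and §1.6 (arXiv p. 6 L126–140, p. 11 L45–54)] -/
theorem eisensteinDVRSettingLevelsTame_fs_natural (k : ℕ) (n : Finset (HeightOneSpectrum (𝓞 K)))
    (v : HeightOneSpectrum (𝓞 K))
    (x : letI := IwasawaAlgebra.isLocalRing_quotient_X_pow_add_C p hm
      galoisCohomology (GaloisRep.toLocal v (W.eisensteinLevelQuot κ hm (k + 1) n)) 1) :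
    letI := IwasawaAlgebra.isDomain_quotient_X_pow_add_C p hm
    letI := IwasawaAlgebra.isDiscreteValuationRing_quotient_X_pow_add_C p hm
    haveI := IwasawaAlgebra.EisensteinCoeff.isLocalRing_succ p hm
    letI := IwasawaAlgebra.EisensteinCoeff.algebraOfSpecSucc p m
    haveI := W.isScalarTower_algebraOfSpecSucc (K := K) (p := p) (m := m)
    letI := W.residueModuleSucc (K := K) (p := p) hm
    ((W.eisensteinDVRSettingLevelsTame κ hm π S hpS hbad L hL hLS jbar cd D).LD k).fs n v ((W.eisensteinDVRSettingLevelsTame κ hm π S hpS hbad L hL hLS jbar cd D).rqLocH1 k n v x) =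
      TensorProduct.map ((W.eisensteinDVRSettingLevelsTame κ hm π S hpS hbad L hL hLS jbar cd D).fsQ k n v).toIntLinearMap LinearMap.id (((W.eisensteinDVRSettingLevelsTame κ hm π S hpS hbad L hL hLS jbar cd D).LD (k + 1)).fs n v x) := by
  letI := IwasawaAlgebra.isDomain_quotient_X_pow_add_C p hm
  letI := IwasawaAlgebra.isDiscreteValuationRing_quotient_X_pow_add_C p hm
  haveI := IwasawaAlgebra.EisensteinCoeff.isLocalRing_succ p hm
  letI := IwasawaAlgebra.EisensteinCoeff.algebraOfSpecSucc p m
  haveI := W.isScalarTower_algebraOfSpecSucc (K := K) (p := p) (m := m)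
  letI := W.residueModuleSucc (K := K) (p := p) hm
  haveI := fun k n ↦ W.finite_eisensteinLevelQuotCarrier (K := K) (p := p) κ hm k n
  exact DVRSetting.fs_natural_of_fs_eq_tameSlotOn (W.eisensteinDVRSettingLevelsTame κ hm π S hpS hbad L hL hLS jbar cd D) π (fun n v ↦ n ∈ levels L ∧ v ∈ n)
    (fun k n v h ↦ W.eisensteinLevels_tameHyp κ hm S hpS hbad L hL hLS k n v h) (fun _ ↦ rfl)
    (fun k n v x ↦ W.eisensteinDVRSetting_fsQ_spec κ hm S hpS hbad L hL hLS jbar cd D (W.eisensteinLevelsTameFs κ hm π S hpS hbad L hL hLS) k n v x) k n v x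

set_option synthInstance.maxHeartbeats 80000 in
/-- **`SatisfiesH` for the levels-tame Eisenstein setting of `E_K`, assembled** (as `eisensteinDVRSettingTame_satisfiesH_of`,
p653070, with the two `fs`-fields swapped): 24 fields by the D1 kernel theorems, the others the EIGHT named hypotheses
`hp2 hK h2 h3 h4 he_red h5b h5c` (+ `(hirr, hschur)` for H.1, `(hc₀, hτ)` for H.5(a)).
[cite: Howard2004HeegnerKolyvagin, §1.3 H.0–H.5 and §1.6 (arXiv p. 7 L55 – p. 8 L1, p. 11 L13–38)] [cite: Gross1984, §1] -/
theorem eisensteinDVRSettingLevelsTame_satisfiesH_of (hp2 : p ≠ 2) (hK : IsImaginaryQuadratic K)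
    (hirr : (W.baseChange K).HasIrreducibleModPGaloisRep p)
    (hschur : ∀ φ : geomTorsion (W.baseChange K) (p : ℤ) →+ geomTorsion (W.baseChange K) (p : ℤ),
      (∀ (g : absoluteGaloisGroup K) (P : geomTorsion (W.baseChange K) (p : ℤ)), φ (g • P) = g • φ P) →
        ∃ c : ℤ, ∀ P : geomTorsion (W.baseChange K) (p : ℤ), φ P = c • P)
    {c₀ : absoluteGaloisGroup ℚ} (hc₀ : IsComplexConjugation (Rat.castHom ℝ) c₀)
    (hτ : ∀ x, cd.τ x = absGaloisTransport (K := ℚ) (L := K) c₀ x)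
    (h2 : letI := IwasawaAlgebra.isLocalRing_quotient_X_pow_add_C p hm
      (W.eisensteinTower κ hm).H2Tower p cd ((W.baseChange K).torsionGaloisModule (p : ℤ)))
    (h3 : letI := IwasawaAlgebra.isLocalRing_quotient_X_pow_add_C p hm
      ∀ k, H3 ((W.eisensteinTower κ hm).ρ k) (IwasawaAlgebra.EisensteinCoeff p m (k + 1))
        (W.eisensteinTowerTriple κ hm S hpS hbad L hL hLS k))
    (h4 : letI := IwasawaAlgebra.isLocalRing_quotient_X_pow_add_C p hm
      ∀ k, (D k).IsSelfOrthogonal (W.eisensteinTowerTriple κ hm S hpS hbad L hL hLS k).cond)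
    (he_red : letI := IwasawaAlgebra.isLocalRing_quotient_X_pow_add_C p hm
      ∀ k (x y : EisensteinLevel p m (fun j ↦ geomTorsion (W.baseChange K) ((p : ℤ) ^ j)) (k + 1 + 1)),
        IwasawaAlgebra.EisensteinCoeff.reduce p m (Nat.le_succ (k + 1)) ((D (k + 1)).e x y) =
          (D k).e ((W.eisensteinTower κ hm).red k x) ((W.eisensteinTower κ hm).red k y))
    (h5b :
    letI := IwasawaAlgebra.isDomain_quotient_X_pow_add_C p hm
    letI := IwasawaAlgebra.isDiscreteValuationRing_quotient_X_pow_add_C p hm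
    haveI := IwasawaAlgebra.EisensteinCoeff.isLocalRing_succ p hm
    letI := IwasawaAlgebra.EisensteinCoeff.algebraOfSpecSucc p m
    haveI := W.isScalarTower_algebraOfSpecSucc (K := K) (p := p) (m := m)
    letI := W.residueModuleSucc (K := K) (p := p) hm
      ∀ k, H5b (R := IwasawaAlgebra.EisensteinCoeff p m (k + 1)) ((W.eisensteinTower κ hm).ρ k)
        (W.isQuotientBy_eisensteinDVRSetting_πbar κ hm S hpS hbad L hL hLS jbar cd D (W.eisensteinLevelsTameFs κ hm π S hpS hbad L hL hLS) k)
        (W.residualTauGeomTorsion (p := p) cd hm (k := k + 1) k.succ_pos)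
        (W.eisensteinTowerTriple κ hm S hpS hbad L hL hLS k).cond)
    (h5c :
    letI := IwasawaAlgebra.isDomain_quotient_X_pow_add_C p hm
    letI := IwasawaAlgebra.isDiscreteValuationRing_quotient_X_pow_add_C p hm
    haveI := IwasawaAlgebra.EisensteinCoeff.isLocalRing_succ p hm
    letI := IwasawaAlgebra.EisensteinCoeff.algebraOfSpecSucc p m
    haveI := W.isScalarTower_algebraOfSpecSucc (K := K) (p := p) (m := m)
    letI := W.residueModuleSucc (K := K) (p := p) hm
      ∀ k, H5c (D k) ((W.eisensteinDVRSettingLevelsTame κ hm π S hpS hbad L hL hLS jbar cd D).πbar k) (W.residualTauGeomTorsion (p := p) cd hm (k := k + 1) k.succ_pos)) :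
    letI := IwasawaAlgebra.isDomain_quotient_X_pow_add_C p hm
    letI := IwasawaAlgebra.isDiscreteValuationRing_quotient_X_pow_add_C p hm
    haveI := IwasawaAlgebra.EisensteinCoeff.isLocalRing_succ p hm
    letI := IwasawaAlgebra.EisensteinCoeff.algebraOfSpecSucc p m
    haveI := W.isScalarTower_algebraOfSpecSucc (K := K) (p := p) (m := m)
    letI := W.residueModuleSucc (K := K) (p := p) hm
    (W.eisensteinDVRSettingLevelsTame κ hm π S hpS hbad L hL hLS jbar cd D).SatisfiesH := by
  letI := IwasawaAlgebra.isDomain_quotient_X_pow_add_C p hm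
  letI := IwasawaAlgebra.isDiscreteValuationRing_quotient_X_pow_add_C p hm
  haveI := IwasawaAlgebra.EisensteinCoeff.isLocalRing_succ p hm
  letI := IwasawaAlgebra.EisensteinCoeff.algebraOfSpecSucc p m
  haveI := W.isScalarTower_algebraOfSpecSucc (K := K) (p := p) (m := m)
  letI := W.residueModuleSucc (K := K) (p := p) hm
  haveI : IsTotallyComplex K := hK.isTotallyComplex
  exact
    { coeffRing := eisensteinDVRSetting_coeffRing (p := p) hm
      p_odd := hp2
      imagQuad := hK
      unif := W.eisensteinDVRSetting_unif κ hm S hpS hbad L hL hLS jbar cd D (W.eisensteinLevelsTameFs κ hm π S hpS hbad L hL hLS)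
      e_strictMono := W.eisensteinDVRSetting_e_strictMono κ hm S hpS hbad L hL hLS jbar cd D (W.eisensteinLevelsTameFs κ hm π S hpS hbad L hL hLS)
      e_zero := W.eisensteinDVRSetting_e_zero κ hm S hpS hbad L hL hLS jbar cd D (W.eisensteinLevelsTameFs κ hm π S hpS hbad L hL hLS)
      killed := W.eisensteinDVRSetting_killed κ hm S hpS hbad L hL hLS jbar cd D (W.eisensteinLevelsTameFs κ hm π S hpS hbad L hL hLS)
      ker_red := W.eisensteinDVRSetting_ker_red κ hm S hpS hbad L hL hLS jbar cd D (W.eisensteinLevelsTameFs κ hm π S hpS hbad L hL hLS)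
      algebraMap_surjective := fun k ↦ eisensteinDVRSetting_algebraMap_surjective (p := p) (m := m) k
      ker_algebraMap := W.eisensteinDVRSetting_ker_algebraMap κ hm S hpS hbad L hL hLS jbar cd D (W.eisensteinLevelsTameFs κ hm π S hpS hbad L hL hLS)
      redR_comp := W.eisensteinDVRSetting_redR_comp κ hm S hpS hbad L hL hLS jbar cd D (W.eisensteinLevelsTameFs κ hm π S hpS hbad L hL hLS)
      scalarLinear := W.eisensteinDVRSetting_scalarLinear κ hm S hpS hbad L hL hLS jbar cd D (W.eisensteinLevelsTameFs κ hm π S hpS hbad L hL hLS)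
      h0 := fun k ↦ W.eisensteinDVRSetting_h0 (K := K) (p := p) hm k
      Sigma_eq := W.eisensteinDVRSetting_t_Sigma κ hm S hpS hbad L hL hLS jbar cd D (W.eisensteinLevelsTameFs κ hm π S hpS hbad L hL hLS)
      cond_smul := W.eisensteinDVRSetting_cond_smul κ hm S hpS hbad L hL hLS jbar cd D (W.eisensteinLevelsTameFs κ hm π S hpS hbad L hL hLS)
      cond_red := W.eisensteinDVRSetting_cond_red κ hm S hpS hbad L hL hLS jbar cd D (W.eisensteinLevelsTameFs κ hm π S hpS hbad L hL hLS)
      L_subset := W.eisensteinDVRSetting_L_subset κ hm S hpS hbad L hL hLS jbar cd D (W.eisensteinLevelsTameFs κ hm π S hpS hbad L hL hLS)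
      L_disjoint := W.eisensteinDVRSetting_L_disjoint κ hm S hpS hbad L hL hLS jbar cd D (W.eisensteinLevelsTameFs κ hm π S hpS hbad L hL hLS)
      primes_eq := W.eisensteinDVRSetting_t_primes κ hm S hpS hbad L hL hLS jbar cd D (W.eisensteinLevelsTameFs κ hm π S hpS hbad L hL hLS)
      h1 := W.eisensteinDVRSetting_h1_of_schur κ hm S hpS hbad L hL hLS jbar cd D (W.eisensteinLevelsTameFs κ hm π S hpS hbad L hL hLS) hirr hschur
      πbar_red := fun k y ↦ W.eisensteinDVRSetting_πbar_red κ hm S hpS hbad L hL hLS jbar cd D (W.eisensteinLevelsTameFs κ hm π S hpS hbad L hL hLS) k y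
      h2 := h2
      h3 := h3
      h4 := h4
      e_red := he_red
      θ_eq := W.eisensteinDVRSetting_θ_eq κ hm S hpS hbad L hL hLS jbar cd D (W.eisensteinLevelsTameFs κ hm π S hpS hbad L hL hLS)
      h5a := W.eisensteinDVRSetting_h5a κ hm S hpS hbad L hL hLS jbar cd D (W.eisensteinLevelsTameFs κ hm π S hpS hbad L hL hLS) hc₀ hτ hp2
      h5b := h5b
      h5c := h5c
      fsQ_spec := W.eisensteinDVRSetting_fsQ_spec κ hm S hpS hbad L hL hLS jbar cd D (W.eisensteinLevelsTameFs κ hm π S hpS hbad L hL hLS)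
      fs_natural := W.eisensteinDVRSettingLevelsTame_fs_natural κ hm π S hpS hbad L hL hLS jbar cd D
      fs_admissible := W.eisensteinDVRSettingLevelsTame_fs_admissible κ hm π S hpS hbad L hL hLS jbar cd D }

end WeierstrassCurve

end
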